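import Summits.BirchSwinnertonDyer.BirchSwinnertonDyer.Theses.KimAtThreeKolyvagin
import HarnessLib

/-! BC3 birth skeleton for crux `KimAtThreeKolyvagin.ShallowEqDeepAtTorsionFree` (route KimAtThreeKolyvagin, rung W2):
v2 (A12-admitted shape, planner g12): named stubs (the ONLY sorried declarations) + the kernel-checked composition `ShallowEqDeepAtTorsionFree_of` concluding the crux BY NAME. -/

noncomputable section

open scoped MatrixGroups ModularForm Classical

open CongruenceSubgroup WeierstrassCurve Literature.NumberTheory.EllipticCurves
  Literature.NumberTheory.EllipticCurves.ModularForms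
  Literature.NumberTheory.EllipticCurves.Kim2025
  Literature.NumberTheory.EllipticCurves.Rank1Residual
  Literature.NumberTheory.EllipticCurves.Rank1Residual.Typed

set_option linter.dupNamespace false

namespace Summit.BirchSwinnertonDyer.BirchSwinnertonDyer.Cruxes.ShallowEqDeepAtTorsionFree.Birth

open Summit.BirchSwinnertonDyer.Rank1Residual.Additive
open Summit.BirchSwinnertonDyer.Rank1Residual.X4
open Summit.BirchSwinnertonDyer.BirchSwinnertonDyer.Theses.KimAtThreeKolyvagin


/-! BC3 birth skeleton for crux `ShallowEqDeepAtTorsionFree` (regime split pot-good / pot-mult at the additive prime 3). -/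

/-- stub (potGood): shallow = deep at `t = 0` on the potentially GOOD additive stratum: the normalisation
exponent `e(Ω⁺) = v₃(c₃) + v₃(c₀) + b ≥ 0` of the optimally normalised integral Kato system (Lemma K with the
pot-good local lattice, Kim–Nakamura 2020 Cor 2.4 / Kim 2026 Lemma 3.10 at `p = 3`) and the dictionary
`δ̃_n = u⁻¹·3^e·x_n` at EVERY level (Prop D), plus deep attainment of `∂^{(∞)}(κ^{Kato})` (MR04 Thm 5.2.12 (i)). -/
theorem stub_shallowEqDeep_potGood :
  ∀ (W : WeierstrassCurve ℚ) [W.IsElliptic] [W.IsGloballyMinimal],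
    (∀ n : ℕ, W.HasSurjectiveModNGaloisRep (3 ^ n : ℕ)) →
    Nat.card {Q : (W.baseChange ℚ_[3]).toAffine.Point // (3 : ℕ) • Q = 0} = 1 →
    Finite W.sha →
    ∀ {N : ℕ} [NeZero N] (f : CuspForm (Gamma0 N) 2), IsNewformOf W f →
    (∀ r : ℚ, ratPlusSymbol f r ≠ 0 → 0 ≤ padicValRat 3 (ratPlusSymbol f r)) →
    kuriharaVanishingOrder W 3 f = 0 →
    0 ≤ padicValRat 3 W.j →
      kuriharaPartialDeepInfty W 3 f ≤ kuriharaPartialInfty W 3 f := by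
  sorry

/-- stub (potMult): the same on the potentially MULTIPLICATIVE additive stratum `ord₃ j(E) < 0` (Kodaira
`I_n^*`): the local lattice `exp*_ω(H¹(ℚ₃,T))` is read off the quadratic twist of the Tate curve instead
(outside Kato Thm 14.5 (3)'s pot-good clause); `e ≥ 0` must be re-proved there. -/
theorem stub_shallowEqDeep_potMult :
  ∀ (W : WeierstrassCurve ℚ) [W.IsElliptic] [W.IsGloballyMinimal],
    (∀ n : ℕ, W.HasSurjectiveModNGaloisRep (3 ^ n : ℕ)) →
    Nat.card {Q : (W.baseChange ℚ_[3]).toAffine.Point // (3 : ℕ) • Q = 0} = 1 →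
    Finite W.sha →
    ∀ {N : ℕ} [NeZero N] (f : CuspForm (Gamma0 N) 2), IsNewformOf W f →
    (∀ r : ℚ, ratPlusSymbol f r ≠ 0 → 0 ≤ padicValRat 3 (ratPlusSymbol f r)) →
    kuriharaVanishingOrder W 3 f = 0 →
    padicValRat 3 W.j < 0 →
      kuriharaPartialDeepInfty W 3 f ≤ kuriharaPartialInfty W 3 f := by
  sorry

/-- BC3 composition = THE SKELETON (A12 shape, v2): the crux BY NAME with NO hypotheses, from exactly the two
registered stubs (pot-good / pot-mult strata at the additive prime 3, `le_or_lt`); kernel-checked, no sorry of its own. -/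
theorem ShallowEqDeepAtTorsionFree_of :
    Summit.BirchSwinnertonDyer.BirchSwinnertonDyer.Theses.KimAtThreeKolyvagin.ShallowEqDeepAtTorsionFree := by
  intro W _ _ htower ht0 hfin N _ f hf hint hord
  by_cases hj : 0 ≤ padicValRat 3 W.j
  · exact stub_shallowEqDeep_potGood W htower ht0 hfin f hf hint hord hj
  · exact stub_shallowEqDeep_potMult W htower ht0 hfin f hf hint hord (not_le.mp hj)

end Summit.BirchSwinnertonDyer.BirchSwinnertonDyer.Cruxes.ShallowEqDeepAtTorsionFree.Birth

end
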